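import Literature.Barriers.PneNP.RigidityCombinatorialBarrier
import HarnessLib

/-!
# Barrier catalogue `PneNP`: the Walsh–Hadamard transform is not Valiant-rigid (Alman–Williams 2017)

D-0021 barrier entry for the summit `PneNP`, bearing — like the sibling entries
`Literature/Barriers/PneNP/RigidityCombinatorialBarrier.lean` (Lokam: limits of untouched-submatrix
and total-nonsingularity arguments) and `Literature/Barriers/PneNP/SuperconcentratorBarrier.lean` —
on the super-linear circuit-size strengthenings of `P ≠ NP` (route PneNP/Circuit, crux
"superlinear size"), here on Valiant's 1977 rigidity road to super-linear lower bounds for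
logarithmic-depth linear circuits, instantiated on its most studied explicit candidate, the
Walsh–Hadamard transform: that road is closed for `H_n`, which is provably NOT rigid enough.

**The printed results (held: J. Alman, R. Williams, *Probabilistic rank and matrix rigidity*,
STOC 2017, arXiv:1611.05558 [AlmanWilliams2017]; `lit read arxiv:1611.05558`, arXiv chunks).**

* §1 (p. 3): "`𝓡_A(r)` is the number of entries of `A` that must be modified in order for the
  rank to drop to `r`"; Valiant 1977: for a linear map `T : 𝔽ⁿ → 𝔽ⁿ` computable by a circuit of
  `O(n)` bounded fan-in addition gates and `O(log n)` depth, `𝓡_T(O(n/log log n)) ≤ n^{1+ε}`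
  for every fixed `ε > 0`; "Among the many attempts to prove arithmetic circuit lower bounds via
  rigidity, perhaps the most commonly studied explicit matrix has been the Walsh–Hadamard
  transform"; p. 4, Def. 1.1: `H_n(v_i, v_j) := (−1)^{⟨v_i, v_j⟩}` on the `2ⁿ` bit vectors; "It
  was believed that `H_n` is rigid because its rows are mutually orthogonal (i.e., `H_n` is
  Hadamard), so in several of the above references, only that property was assumed"; best lower
  bound `𝓡_{H_n}(r) ≥ Ω(4ⁿ/r)`.
* **Thm. 1.1** (p. 4; = Thm. of §3, p. 8) "(Non-Rigidity of Hadamard Matrices). For every field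
  `K`, for every sufficiently small `ε > 0`, and for all `n`, we have
  `𝓡_{H_n}(2^{n − f(ε)n}) ≤ 2^{n(1+ε)}` over `K`, for a function `f` where
  `f(ε) = Θ(ε²/log(1/ε))`." (The last clause over-states the proved exponent by one logarithm —
  see the next paragraph.) P. 4: "by modifying at most `2^{εn}` entries in each row of `H_n`,
  the rank of `H_n` drops to `2^{n−f(ε)n}`. That is, the matrix rigidity approach to arithmetic
  circuit lower bounds does not apply to Hadamard matrices such as the Walsh–Hadamard transform.
  We would have required lower bounds of the form `𝓡_{H_n}(2ⁿ/(log n)) ≥ 2^{n(1+ε)}` for some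
  `ε > 0` to obtain circuit lower bounds; the upper bound of Theorem 1.1 shows this is impossible."
  "We do not (yet) believe that the Walsh–Hadamard transform has `O(2ⁿ)`-size `O(n)`-depth
  circuits; a more appropriate conclusion is that rigidity is too coarse to adequately capture the
  lower bound problem in this case." Same page: Thm. 1.1 yields "a depth-two unbounded fan-in
  arithmetic circuit for the Walsh–Hadamard transform with `2^{n+O(ε log(1/ε)) n} + 2^{2n−Ω(ε² n)}`
  gates".
* §3 (pp. 8–9), the proof: Lemma 3.1 (a multilinear polynomial over `K` with `2^{n−Ω(ε²n)}`
  monomials equal to `(−1)^{⟨x,y⟩}` whenever `⟨x, y⟩ ∈ [2εn, (1/2+ε)n]`, from integer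
  interpolation on Hamming weights), Lemma 3.3 (few balanced `y` have small inner product with a
  balanced `x`: probability `≤ g(n)·2^{(f(a,b)−1)n}`,
  `f(a,b) = (1/2+a)(4b log(1/2b) + (8a+4b) log(1/(4a+2b)))`), Lemma 3.4 / Cor. 3.1 (correcting
  `k` columns and `ℓ` rows costs rank `k + ℓ`); last paragraph (p. 9): "Now for sufficiently large
  `n` and `ε ∈ (0,1/2)`, `M'` has rank at most `m + 4·n·2^{n−Ω(ε²n)} ≤ 5n·2^{n−Ω(ε²n)}`.
  Furthermore, on every row, `M'` differs from `H_n` in at most `n²·2^{f(ε,ε)} ≤ 2^{O(ε log(1/ε)n)}`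
  entries."
* Thm. 1.2 (p. 4): `2^{2n}/r` changes give rank `(n/ln r)^{O(√(n log r))}` (the high-error
  regime of communication complexity); Thm. 1.5 (p. 5): over fields, rigidity of `H_n` and
  `ε`-probabilistic rank are equivalent.
* Z. Dvir, A. Liu, *Fourier and circulant matrices are not rigid*, CCC 2019 [DvirLiu2019]
  (abstract, held): Fourier / circulant / Toeplitz matrices "are not sufficiently rigid to carry
  out Valiant's approach". S. Lokam, *Complexity lower bounds using linear algebra* (2009)
  [Lokam2009], Thm. 2.1 (PDF p. 17): Valiant's criterion (`𝓡_A(εn) ≥ n^{1+δ}` ⇒ size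
  `Ω(n log log n)` for log-depth linear circuits), Open Question 2.1 (PDF p. 15).

**The exponent: what is printed, what is proved, and what this entry states (named-fact verdict
clean-up, 2026-08-16).** The clause "`f(ε) = Θ(ε²/log(1/ε))`" of Thm. 1.1 is stronger, by one
logarithm, than what the printed proof delivers. §3 works with a parameter `a` (written `ε`
there) and ends, as quoted above, with rank `5n·2^{n−Ω(a²n)}` after `≤ 2^{O(a log(1/a) n)}`
changes per row (likewise the depth-two circuit count `2^{n+O(ε log(1/ε))n} + 2^{2n−Ω(ε²n)}` on
p. 4); so `2^{(1+ε')n}` changes in total, `ε' = Θ(a log(1/a))`, buy the rank deficit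
`Θ(a²) = Θ(ε'²/log²(1/ε'))`. The later literature states and uses the square:
[Alman2021Kronecker] §1.1 — "using the rigidity upper bound `𝓡_{H_n}(N^{1−Θ(ε²/log²(1/ε))}) ≤ N^{1+ε}`
for any `ε > 0` of [AW17]"; ibid. §5, Thm. 5.2 — "For sufficiently small `ε > 0` we have
`𝓡^{rc}_{R_n}(2^{(1−Θ(ε²/log²(1/ε)))·n}) ≤ 2^{ε·n}`" (proof: "`δ² = Θ(ε²/log²(1/ε))`");
[Kivva2021] §1.1, Thm. 1.2 (Alman's theorem for Kronecker products of `d × d` matrices, rank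
`n^{1−γ}` at `n^{1+ε}` changes with `γ = Ω_d(ε²/log²(1/ε))`). The single-logarithm form is
established neither in [AlmanWilliams2017] (whose §3 gives the square) nor in the later sources
read here, which state the square. Until 2026-08-16 the def `HadamardNotRigid` below rendered the
printed sentence (`Real.log (1 / ε)` in the rank exponent), i.e. an unproved strengthening of what
is established; the prove-seat that found this returned the verdict MIS-STATED and vendored the
corrected statement, with a complete proof over every field, as `HadamardNotRigidLogSq` /
`HadamardNotRigidLogSq_holds` in the companion `Literature/Barriers/PneNP/HadamardNotRigidProofs.lean`
(which imports this file). This clean-up RESTATES THE ENTRY IN PLACE (human ruling 2026-08-15 on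
mis-stated facts: restate, do not delete; keep the old name when the correction is
meaning-preserving for its users): `HadamardNotRigid` now carries `Real.log (1 / ε) ^ 2` — token
for token the statement `HadamardNotRigidLogSq`, which cannot be referred to by name from this
file (it is declared downstream) and which the companion keeps, with its proof and under that
second name, as the same proposition; the companion also carries the discharge under this name,
`HadamardNotRigid_holds` (appended by the same clean-up). The correction replaces one
constant-type token inside the rank exponent and preserves the meaning for every user: the
route-facing readings `HadamardNotRigid.no_valiant_rigidity` / `.no_valiant_rigidity_log` below
need only SOME positive deficit `θ(ε) → 0` and keep their statements (their unconditional forms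
`walshHadamard_no_valiant_rigidity`, `walshHadamard_no_valiant_rigidity_log` are proved in the
companion); the companion's `HadamardNotRigid.logSq : HadamardNotRigid → HadamardNotRigidLogSq` is
now immediate; idea cards cite the barrier, not the exponent. The single-logarithm statement
survives only as the quotation above. Locators "p. N" for [AlmanWilliams2017] are chunk numbers
of the held text (`lit read arxiv:1611.05558`), not PDF pages.

**What this file adds.** The Walsh–Hadamard / Sylvester matrix `walshHadamard K n` over any
field (entries `(−1)^{⟨i,j⟩}`, `⟨i,j⟩` = number of common `1`-bits of `i, j < 2ⁿ`; Alman–Williams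
index by the lexicographic enumeration of `{0,1}ⁿ` — rigidity is invariant under the simultaneous
row/column permutation, so the enumeration is immaterial; over `ℝ` it agrees entrywise with the
tree's sign kernel `Literature.Computability.QuantumComplexity.hadamardSign n i j`
(`RazTalForrelation.lean`, the same `testBit` indexing; that file's `hadamardMatrix` is the
`2^{-n/2}`-normalised real transform) — kept field-generic here because Thm. 1.1 is over every
field, a librarian may unify the two later), the tree's `rigidity A r`
(`RigidityCombinatorialBarrier.lean`, Lokam Def. 2.1 via `Matrix.rank`) with its antitonicity in
the target rank (`rigidity_anti`, proved), the named fact `HadamardNotRigid` (Thm. 1.1 with the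
exponent its proof establishes, the `Θ` opened to the side that matters,
`f(ε) ≥ c·ε²/log²(1/ε)`, constants depending on the field — weakenings; PROVED in the companion),
and the proved route-facing reading `HadamardNotRigid.no_valiant_rigidity`: for every field and
every `δ > 0`, eventually `𝓡_{H_n}(⌊2ⁿ/n⌋) < 2^{(1+δ)n}` — no rigidity bound of Valiant strength
holds for `H_n`. The proof of the fact (Alman's disjointness decomposition, binomial tails) is
deliberately NOT here but in the companion, which needs heavier imports.

## Sources

* [AlmanWilliams2017] abstract (arXiv p. 2), §1 and Def. 1.1, Thm. 1.1–1.2, 1.5 (pp. 3–5), §3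
  (pp. 8–9: Lemmas 3.1–3.4, Cor. 3.1, proof of Thm. 1.1) — held, read.
* [Alman2021Kronecker] arXiv:2102.11992 §1.1, §1.3, §5 (Lemma 5.1, Thm. 5.2); [Kivva2021]
  arXiv:2103.05631 §1.1 (Thm. 1.2) — held, read (for the exponent).
* [DvirLiu2019] abstract (arXiv p. 2) — held. [Lokam2009] Def. 2.1, Thm. 2.1, Open Question 2.1
  (PDF pp. 14–17) — held (through the sibling entry).
-/

noncomputable section

namespace Literature.Barriers.PneNP

open Finset Filter

universe u

/-! ### The Walsh–Hadamard matrices -/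

/-- The integer inner product `⟨v_i, v_j⟩` of the bit vectors of `i, j < 2ⁿ` (number of
positions `l < n` where both have a `1`). [cite: AlmanWilliams2017, Def. 1.1 (arXiv p. 4)] -/
def bitInner (n : ℕ) (i j : Fin (2 ^ n)) : ℕ :=
  (univ.filter fun l : Fin n => i.val.testBit l = true ∧ j.val.testBit l = true).card

/-- **The Walsh–Hadamard (Sylvester) matrix `H_n` over a field `K`**: the `2ⁿ × 2ⁿ` matrix
`H_n(v_i, v_j) = (−1)^{⟨v_i, v_j⟩}` — the communication matrix of Inner Product mod `2` in `±1`
form. (Indexed by `i, j < 2ⁿ` through binary representations rather than Alman–Williams'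
lexicographic enumeration; the two differ by a simultaneous permutation of rows and columns,
which does not change rank or rigidity.) [cite: AlmanWilliams2017, Def. 1.1 (arXiv p. 4)] -/
def walshHadamard (K : Type*) [Field K] (n : ℕ) : Matrix (Fin (2 ^ n)) (Fin (2 ^ n)) K :=
  fun i j => (-1 : K) ^ bitInner n i j

/-- Entries of `H_n` are `±1`. [cite: AlmanWilliams2017, Def. 1.1 (arXiv p. 4)] -/
theorem walshHadamard_apply_sq (K : Type*) [Field K] (n : ℕ) (i j : Fin (2 ^ n)) :
    walshHadamard K n i j ^ 2 = 1 := by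
  rw [walshHadamard, ← pow_mul, mul_comm, pow_mul, neg_one_sq, one_pow]

/-! ### Rigidity is antitone in the target rank -/

/-- Lowering the rank further never needs fewer changes: `r ≤ r' → 𝓡_A(r') ≤ 𝓡_A(r)`.
[cite: Lokam2009, Def. 2.1 (PDF p. 14)] -/
theorem rigidity_anti {m : ℕ} {F : Type*} [Field F] (A : Matrix (Fin m) (Fin m) F) {r r' : ℕ}
    (h : r ≤ r') : rigidity A r' ≤ rigidity A r := by
  have hne : {s | ∃ C : Matrix (Fin m) (Fin m) F, (A + C).rank ≤ r ∧ nnzEntries C = s}.Nonempty :=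
    ⟨nnzEntries (-A), -A, by simp [Matrix.rank_zero], rfl⟩
  obtain ⟨C, hC, hs⟩ := Nat.sInf_mem hne
  unfold rigidity
  rw [← hs]
  exact Nat.sInf_le ⟨C, hC.trans h, rfl⟩

/-! ### The barrier fact -/

/-- **The Walsh–Hadamard transform is not Valiant-rigid (Alman–Williams 2017, Thm. 1.1, with the
exponent its proof establishes; Alman 2021, Thm. 5.2).** For every field `K` (in any universe
`u`; the fact is `HadamardNotRigid.{u}`) there are `c > 0` and `ε₀ ∈ (0, 1)` such that for every
`ε ∈ (0, ε₀]` and all SUFFICIENTLY LARGE `n`, at most `2^{(1+ε)n}` entries of `H_n` need to be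
changed to bring its rank over `K` down to `2^{(1 − c·ε²/log²(1/ε))·n}`. (Printed, Thm. 1.1: "For
every field `K`, for every sufficiently small `ε > 0`, and for all `n`, we have
`𝓡_{H_n}(2^{n−f(ε)n}) ≤ 2^{n(1+ε)}` over `K`, for a function `f` where `f(ε) = Θ(ε²/log(1/ε))`."
The exponent is vendored as PROVED, `Θ(ε²/log²(1/ε))` — what §3 of the source yields
(`2^{O(a log(1/a))n}` changes per row at rank `5n·2^{n−Ω(a²n)}`, p. 9) and what
[Alman2021Kronecker] §1.1 and §5 Thm. 5.2 state; the printed single logarithm is stronger by one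
`log(1/ε)` and established nowhere in these sources (module docstring). This def rendered the
printed single logarithm until the named-fact verdict clean-up of 2026-08-16 restated it in place
— one token, `Real.log (1 / ε) ^ 2`; meaning-preserving for every user. Further, as before: the
printed proof gives the bound for `n ≥ n₀(ε)` only ("Now for sufficiently large `n` …", p. 9),
hence `∀ᶠ n`, like the sibling `Lokam2009_thm_2_12`; only the lower bound `f(ε) ≥ c·ε²/log²(1/ε)`
of the `Θ` is used — by `rigidity_anti` it is the informative side; and `c, ε₀` may depend on `K`
(the proofs give absolute constants) — all weakenings of the printed sentence.) PROVED in the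
companion `HadamardNotRigidProofs.lean` (downstream of this file), which states this proposition
a second time, token for token, as `HadamardNotRigidLogSq` (vendored there while this entry was
parked as mis-stated) and proves it for every field with `c = 1/400`, `ε₀ = 1/30` by Alman's
disjointness decomposition (`rigidity_walshHadamard_le_rpow`, `HadamardNotRigidLogSq_holds`; the
discharge under this name, `HadamardNotRigid_holds`, is appended there by the same clean-up).
Route-facing reading: `HadamardNotRigid.no_valiant_rigidity` below; unconditional form
`walshHadamard_no_valiant_rigidity` in the companion.

BARRIER
technique_class: valiant-rigidity, matrix-rigidity, rigidity-of-hadamard-matrices, walsh-hadamard-transform, sylvester-matrices, inner-product-matrix, hadamard-orthogonality-arguments, linear-circuit-lower-bounds-via-rigidity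
blocks: Valiant's rigidity road (Lokam Thm. 2.1: `𝓡_A(εn) ≥ n^{1+δ}` for some `ε, δ > 0` ⇒ every `O(log n)`-depth linear circuit for `x ↦ Ax` has size `Ω(n log log n)`; cf. route PneNP/Circuit crux "superlinear size") [cite: Lokam2009, Thm. 2.1 (PDF p. 17) and Open Question 2.1 (PDF p. 15)] for the explicit family `A = H_n` (`N = 2ⁿ`), "perhaps the most commonly studied explicit matrix" of that programme, and every argument using only the Hadamard (orthogonal `±1` rows) property, since `H_n` is Hadamard [cite: AlmanWilliams2017, §1 (arXiv pp. 3–4)]: "We would have required lower bounds of the form `𝓡_{H_n}(2ⁿ/(log n)) ≥ 2^{n(1+ε)}` for some `ε > 0` to obtain circuit lower bounds; the upper bound of Theorem 1.1 shows this is impossible" — formally `HadamardNotRigid.no_valiant_rigidity` (unconditionally `walshHadamard_no_valiant_rigidity` in the companion): for every `δ > 0`, eventually `𝓡_{H_n}(⌊2ⁿ/n⌋) < 2^{(1+δ)n}` [cite: AlmanWilliams2017, Thm. 1.1 and the paragraph after it (arXiv p. 4)].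
because: over any field a multilinear polynomial with only `2^{n−Ω(a²n)}` monomials (integer interpolation on Hamming weights, reduced modulo the characteristic) computes `(−1)^{⟨x,y⟩}` exactly whenever `⟨x,y⟩ ∈ [2an, (1/2+a)n]`, i.e. a matrix of rank `2^{n−Ω(a²n)}` agrees with `H_n` there (Lemma 3.1); rows and columns indexed by unbalanced vectors (`|v| ∉ [(1/2−a)n, (1/2+a)n]`) are corrected at rank cost one each, `4n·2^{n−Ω(a²n)}` in all (Lemma 3.4, Cor. 3.1); the remaining wrong entries are balanced pairs with inner product `< 2an`, at most `n²·2^{f(a,a)n} ≤ 2^{O(a log(1/a))n}` per row (Lemma 3.3) — so rank `5n·2^{n−Ω(a²n)}` after `2^{O(a log(1/a))n}` changes per row, i.e. `2^{(1+ε)n}` changes for rank `2^{(1−Θ(ε²/log²(1/ε)))n}` [cite: AlmanWilliams2017, §3, Lemmas 3.1–3.4, Cor. 3.1 and the proof of Thm. 1.1 (arXiv pp. 8–9)]; second proof (the one formalised in the companion): `H_n(x,y) = ∑_{z ⊆ x∩y} (−2)^{|z|}`, the terms with `|z| < (1/2−δ)n` have rank `≤ 2^{(1−Θ(δ²))n}`,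 the rows and columns with `|x| > (1/2+δ)n` are `2·2^{(1−Θ(δ²))n}` rank-one updates, and what is left is supported where `|x ∩ y| ≥ (1/2−δ)n`, `2^{Θ(δ log(1/δ))n}` entries per row, `δ = Θ(ε/log(1/ε))` [cite: Alman2021Kronecker, §1.3 and §5, Lemma 5.1, Thm. 5.2].
evasions_known: pick other explicit candidates — but several classical ones fell the same way: Fourier, circulant and Toeplitz matrices "are not sufficiently rigid to carry out Valiant's approach" [cite: DvirLiu2019, abstract (arXiv p. 2)], as did Kronecker products of bounded-size matrices [cite: Alman2021Kronecker, §1.3, Thm. 1.8] and [cite: Kivva2021, §1.1–1.2, Thms. 1.2–1.4]; the authors' own reading: "We do not (yet) believe that the Walsh–Hadamard transform has `O(2ⁿ)`-size `O(n)`-depth circuits; a more appropriate conclusion is that rigidity is too coarse to adequately capture the lower bound problem in this case" — i.e. prove linear-circuit lower bounds for `H_n` by a finer invariant than rigidity [cite: AlmanWilliams2017, §1 (arXiv p. 4)]; in the high-error regime relevant to communication complexity the known upper bound (Thm. 1.2: `2^{2n}/r` changes, rank `(n/ln r)^{O(√(n log r))}`) "is not small enough to refute the conjectured rigidity lower bounds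 required for communication complexity applications", and over fields rigidity of `H_n` is equivalent to its probabilistic rank, so "to prove rigidity upper bounds, one only has to think about communication protocols for IP2" [cite: AlmanWilliams2017, Thm. 1.2 (arXiv p. 4) and Thm. 1.5 (arXiv p. 5)].
scope_caveats: a statement about ONE explicit family (`H_n`, hence Sylvester-type Hadamard matrices) in Valiant's LOW-error regime (rank `2^{(1−Θ(ε²/log²(1/ε)))n} = N^{1−Θ(ε²/log²(1/ε))}`, `N^{1+ε}` changes); it says nothing about other Hadamard matrices over their field of definition (e.g. Paley type), about rigidity at much smaller rank / higher error (Thm. 1.2's regime, where the conjectured communication-complexity rigidity is not refuted), or about the actual linear-circuit complexity of `H_n` (no upper bound on circuits is claimed beyond the depth-two `4^{δn}`, `δ < 1`, construction) [cite: AlmanWilliams2017, §1 (arXiv p. 4)]; vendored for all sufficiently large `n` (`∀ᶠ n`, what the printed proof on p. 9 gives; the printed theorem says "for all `n`"), with the `Θ` opened to `∃ c > 0, f(ε) ≥ c·ε²/log²(1/ε)` and with `c, ε₀` depending on the field (the printed function `f` is absolute; the companion proves absolute `c = 1/400`, `ε₀ = 1/30`) — weakenings; the EXPONENT is the proved `Θ(ε²/log²(1/ε))`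 of §3 and [cite: Alman2021Kronecker, §1.1 and §5 Thm. 5.2], NOT the printed `Θ(ε²/log(1/ε))`, which is stronger by one logarithm and is not vendored (this entry rendered it until the verdict clean-up of 2026-08-16 restated it in place); the per-row form ("at most `2^{εn}` entries in each row") is quoted, not vendored; Valiant's criterion (Lokam Thm. 2.1) and linear circuits are quoted, not formalised (no linear-circuit model in the tree), exactly as in `RigidityCombinatorialBarrier.lean`.
status: established — theorem with the exponent `Θ(ε²/log²(1/ε))` (PROVED for every field in the companion `HadamardNotRigidProofs.lean`: `rigidity_walshHadamard_le_rpow`, `HadamardNotRigidLogSq_holds`, `HadamardNotRigid_holds`) [cite: AlmanWilliams2017, Thm. 1.1 (arXiv p. 4; §3 pp. 8–9 for the proof and the exponent)]; [cite: Alman2021Kronecker, §1.1 and §5 Thm. 5.2] -/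
def HadamardNotRigid : Prop :=
  ∀ (K : Type u) [Field K], ∃ c : ℝ, 0 < c ∧ ∃ ε₀ : ℝ, 0 < ε₀ ∧ ε₀ < 1 ∧
    ∀ ε : ℝ, 0 < ε → ε ≤ ε₀ → ∀ᶠ n : ℕ in atTop,
      (rigidity (walshHadamard K n)
          ⌊(2 : ℝ) ^ ((1 - c * ε ^ 2 / Real.log (1 / ε) ^ 2) * n)⌋₊ : ℝ)
        ≤ (2 : ℝ) ^ ((1 + ε) * n)

/-! ### The route-facing reading (proved from the fact) -/

/-- Exponential beats linear: for `θ > 0`, eventually `n ≤ 2^{θ n}` (from `exp x ≥ 1 + x`).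
[folklore] -/
theorem eventually_nat_le_two_rpow_mul {θ : ℝ} (hθ : 0 < θ) :
    ∀ᶠ n : ℕ in atTop, (n : ℝ) ≤ (2 : ℝ) ^ (θ * n) := by
  have hlog : 0 < Real.log 2 := Real.log_pos one_lt_two
  set a : ℝ := θ * Real.log 2 / 2 with ha
  have ha0 : 0 < a := by positivity
  refine eventually_atTop.2 ⟨⌈1 / a ^ 2⌉₊, fun n hn => ?_⟩
  have hn : 1 / a ^ 2 ≤ n := (Nat.le_ceil _).trans (by exact_mod_cast hn)
  have hn0 : (0 : ℝ) ≤ n := Nat.cast_nonneg n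
  -- `2^(θ n) = exp(2 a n) = (exp (a n))² ≥ (1 + a n)² ≥ a² n² ≥ n`
  have hexp : (2 : ℝ) ^ (θ * n) = Real.exp (a * n) ^ 2 := by
    rw [Real.rpow_def_of_pos two_pos, ← Real.exp_nat_mul]
    congr 1
    rw [ha]; push_cast; ring
  rw [hexp]
  have h1 : 1 + a * n ≤ Real.exp (a * n) := by
    have := Real.add_one_le_exp (a * n); linarith
  have h2 : 0 ≤ 1 + a * n := by positivity
  calc (n : ℝ) ≤ a ^ 2 * n ^ 2 := by
        have : 1 ≤ a ^ 2 * n := by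
          rw [div_le_iff₀ (by positivity)] at hn; linarith
        nlinarith
    _ ≤ (1 + a * n) ^ 2 := by nlinarith
    _ ≤ Real.exp (a * n) ^ 2 := pow_le_pow_left₀ h2 h1 2

/-- **No Valiant-strength rigidity for the Walsh–Hadamard transform**: granted
`HadamardNotRigid`, for every field `K` and every `δ > 0`, for all large `n` the rigidity of
`H_n` at target rank `⌊2ⁿ/n⌋ = N/log₂ N` is `< 2^{(1+δ)n} = N^{1+δ}`. This rank is BELOW the
paper's `2ⁿ/log n` (`= N/log log N`, Valiant's regime), so by antitonicity this is the stronger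
statement; the paper's form is `no_valiant_rigidity_log`. Hence no bound
`𝓡_{H_n}(2ⁿ/log n) ≥ 2^{(1+δ)n}` (let alone at rank `2ⁿ/n`) holds infinitely often, which is what
the rigidity road would need. (Uses only that the deficit `θ = c·ε²/log²(1/ε)` is positive, so
`n ≤ 2^{θn}` eventually; unconditional form, fed by the companion's proof of the fact:
`walshHadamard_no_valiant_rigidity` in `HadamardNotRigidProofs.lean`.) [cite: AlmanWilliams2017, §1 (arXiv p. 4: "We would have required lower bounds of the form 𝓡_{H_n}(2ⁿ/(log n)) ≥ 2^{n(1+ε)} for some ε > 0 … Theorem 1.1 shows this is impossible")] -/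
theorem HadamardNotRigid.no_valiant_rigidity (h : HadamardNotRigid.{u}) (K : Type u) [Field K]
    {δ : ℝ} (hδ : 0 < δ) :
    ∀ᶠ n : ℕ in atTop,
      (rigidity (walshHadamard K n) (2 ^ n / n) : ℝ) < (2 : ℝ) ^ ((1 + δ) * n) := by
  obtain ⟨c, hc, ε₀, hε₀, hε₁, hK⟩ := h K
  -- a fixed admissible `ε ≤ δ/2`
  set ε : ℝ := min ε₀ (δ / 2) with hε
  have hεpos : 0 < ε := lt_min hε₀ (by linarith)
  have hεle : ε ≤ ε₀ := min_le_left _ _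
  have hεlt1 : ε < 1 := hεle.trans_lt hε₁
  have hεδ : ε ≤ δ / 2 := min_le_right _ _
  set θ : ℝ := c * ε ^ 2 / Real.log (1 / ε) ^ 2 with hθ
  have hlogpos : 0 < Real.log (1 / ε) := Real.log_pos (by rw [lt_div_iff₀ hεpos]; linarith)
  have hθpos : 0 < θ := by positivity
  filter_upwards [eventually_nat_le_two_rpow_mul hθpos, eventually_gt_atTop 0, hK ε hεpos hεle]
    with n hn hn0 hfact
  have hn0' : (0 : ℝ) < n := by exact_mod_cast hn0
  -- the fact at `ε`, target rank `⌊2^{(1-θ)n}⌋`, is `hfact`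
  -- `⌊2^{(1-θ) n}⌋ ≤ 2^n / n` (naturals), since `n ≤ 2^{θ n}`
  have hrank : ⌊(2 : ℝ) ^ ((1 - c * ε ^ 2 / Real.log (1 / ε) ^ 2) * n)⌋₊ ≤ 2 ^ n / n := by
    rw [← hθ]
    refine (Nat.le_div_iff_mul_le hn0).2 ?_
    have key : (2 : ℝ) ^ ((1 - θ) * n) * n ≤ (2 : ℝ) ^ (n : ℝ) := by
      calc (2 : ℝ) ^ ((1 - θ) * n) * n ≤ (2 : ℝ) ^ ((1 - θ) * n) * (2 : ℝ) ^ (θ * n) :=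
            mul_le_mul_of_nonneg_left hn (by positivity)
        _ = (2 : ℝ) ^ (n : ℝ) := by
            rw [← Real.rpow_add two_pos]; congr 1; ring
    have hfloor : (⌊(2 : ℝ) ^ ((1 - θ) * n)⌋₊ : ℝ) ≤ (2 : ℝ) ^ ((1 - θ) * n) :=
      Nat.floor_le (by positivity)
    have : ((⌊(2 : ℝ) ^ ((1 - θ) * n)⌋₊ * n : ℕ) : ℝ) ≤ ((2 ^ n : ℕ) : ℝ) := by
      push_cast
      rw [Real.rpow_natCast] at key
      nlinarith
    exact_mod_cast this
  have hmono := rigidity_anti (walshHadamard K n) hrank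
  calc (rigidity (walshHadamard K n) (2 ^ n / n) : ℝ)
      ≤ rigidity (walshHadamard K n)
          ⌊(2 : ℝ) ^ ((1 - c * ε ^ 2 / Real.log (1 / ε) ^ 2) * n)⌋₊ := by
        exact_mod_cast hmono
    _ ≤ (2 : ℝ) ^ ((1 + ε) * n) := hfact
    _ < (2 : ℝ) ^ ((1 + δ) * n) := by
        refine Real.rpow_lt_rpow_of_exponent_lt one_lt_two ?_
        have : (1 + ε) < (1 + δ) := by linarith
        exact mul_lt_mul_of_pos_right this hn0'

/-- The paper's form: for every `δ > 0`, eventually `𝓡_{H_n}(⌊2ⁿ/log₂ n⌋) < 2^{(1+δ)n}` —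
"lower bounds of the form `𝓡_{H_n}(2ⁿ/(log n)) ≥ 2^{n(1+ε)}` for some `ε > 0` … [are]
impossible" (from `no_valiant_rigidity` by `rigidity_anti`, as `2ⁿ/n ≤ 2ⁿ/log₂ n`; unconditional
form `walshHadamard_no_valiant_rigidity_log` in the companion).
[cite: AlmanWilliams2017, §1 (arXiv p. 4)] -/
theorem HadamardNotRigid.no_valiant_rigidity_log (h : HadamardNotRigid.{u}) (K : Type u) [Field K]
    {δ : ℝ} (hδ : 0 < δ) :
    ∀ᶠ n : ℕ in atTop,
      (rigidity (walshHadamard K n) (2 ^ n / Nat.log 2 n) : ℝ) < (2 : ℝ) ^ ((1 + δ) * n) := by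
  filter_upwards [h.no_valiant_rigidity K hδ, eventually_ge_atTop 2] with n hn hn2
  have hlog : 0 < Nat.log 2 n := Nat.log_pos one_lt_two hn2
  have hrank : 2 ^ n / n ≤ 2 ^ n / Nat.log 2 n :=
    Nat.div_le_div_left (Nat.log_le_self 2 n) hlog
  calc (rigidity (walshHadamard K n) (2 ^ n / Nat.log 2 n) : ℝ)
      ≤ rigidity (walshHadamard K n) (2 ^ n / n) := by
        exact_mod_cast rigidity_anti (walshHadamard K n) hrank
    _ < (2 : ℝ) ^ ((1 + δ) * n) := hn

end Literature.Barriers.PneNP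

end
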